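import Summits.Ventures.CertifiedManyBodySolver.Observables.PairAmplitudeGroundStateClassCeiling
import Literature.MathematicalPhysics.QuantumLattice.HubbardEnergyDensityChemicalPotential
import HarnessLib

/-!
# OP1-C in IDENTITY FORM, part 4: the GRAND-CANONICAL cell (cap on `e − μ'ρ`, no use of the density) and the
# first reader for a certified CEILING on the Koma–Tasaki `d`-wave ORDER PARAMETER `m⋆(μ)` over a `μ`-bracket

HONEST FRAMING: soundness / bookkeeping theorems for a CEILING route at positivity scale; a ceiling never
speaks to the presence of pairing; not a superconductivity verdict; nothing in this file is a number and NO
certificate of this (grand-canonical) form exists yet — the file says what such a certificate would prove. Crew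
hubbard-obs (D-0042), seat hubbard-obs-p1 (`prover-hubbard-obs-p1-g11-0`), PAIRCORR-SDP §19.8. Zero compute; no
definition; no named fact; no `sorry`.

Parts 1–3 read a `μ'`-cell certificate in translation-invariant ground states of `H^{tt'} − μ_c N` OF DENSITY `n`: the
cap row `e^{tt'}(ω) ≤ u` is discharged from `e(n) ≤ u`, and the filling rows read `(Σμ_σ)(n/2 − ν)`. The quasi-average
ORDER PARAMETER `m⋆(μ) = dWaveOrderParameterTT' t' U μ` (`= lim inf_{h→0⁺} lim inf_L` of the pinned-torus pair densities
`= −∂⁺_h E(μ,h)|₀/2 =` the largest `Re ω(P₀^d)` over ALL translation-invariant ground states `ω` of `H^{tt'} − μN`,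
`DWaveOrderParameterInfiniteVolume`) ranges over ground states of EVERY density, so it is NOT bounded by those
certificates. This part types the certificate class that DOES bound it — the GRAND-CANONICAL cell: no filling rows
needed (they may be present, then they read `(Σμ_σ)(ρ(ω)/2 − ν)`), and the cap row on the grand-canonical energy at the
GRID point, `κ⁺ (u·1 − Γ E^{src}_{μ',0})`, `E^{src}_{μ',0} = H^{tt'} − μ' N` (`e^{src}_{μ',0}(ω) = e^{tt'}(ω) − μ' ρ(ω)`):

* §1 `re_sum_twistedFlipAct_expect_ge_of_chargedCell_certificate_gc` — the cell reader of part 1 with this cap row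
  (the zero-field instance of the hubbard-cq reader's cap slot); §2 `two_mul_re_expect_localPairAt_le_of_chargedCell_certificate_gc`.
* §3 `meanEnergy_sourced_grid_le_of_cell` — CAP DISCHARGE on the class WITHOUT the density: a translation-invariant
  minimiser `ω` of `H^{tt'} − μ_c N` (`|μ' − μ_c| ≤ Δ`) has, for every `n₀ ∈ [0,2)`,
  `e^{src}_{μ',0}(ω) ≤ e(n₀) − μ' n₀ + Δ |ρ(ω) − n₀| ≤ e(n₀) − μ' n₀ + 2Δ` (`e_GC(μ_c) ≤ e(n₀) − μ_c n₀`): a certified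
  canonical cap `e(n₀) ≤ hi` gives the cell cap `u_j = hi − μ'_j n₀ + 2Δ_j` (or `+ Δ_j D` with a certified density window).
* §4 THE CONSUMERS: grand-canonical cell sentences «every translation-invariant minimiser `ω` of `H^{tt'} − μ_c N` with
  `|μg j − μ_c| ≤ Δg j` and `e^{src}_{μg j,0}(ω) ≤ ug j` has `Re ω(P₀^d) ≤ M j`» over cells covering `[μlo, μhi]`, with
  `ug j ≥ hi − μg j·n₀ + 2Δg j`, give for EVERY `μ ∈ [μlo, μhi]`: `Re ω(P₀^d) ≤ B` and `|ω(P₀^d)| ≤ B` for every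
  translation-invariant ground state of `H^{tt'} − μN` (any density; gauge rotation), hence
  **`dWaveOrderParameterTT'_le_of_gcCells`: `m⋆(μ) ≤ B` on the whole bracket** (the maximiser is such a ground state,
  `exists_isMeanEnergyMinimiser_two_mul_re_expect_localPairAt_eq_neg_rightDeriv`), and
  `boxPairLRO_le_of_isErgodic_gcCells`: every ergodic such ground state has box pair-LRO `→ |ω(P₀^d)|² ≤ B²`.

What a producer would run (not run today): the B0-class (or union) gauge-broken one-point MAX program per `μ'`-cell with
the cap row on `h − μ' n̂` at `u_j = hi(#354) − μ'_j·(7/8) + 2Δ_j` (filling rows optional), charged slack rows and kkt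
cells as in part 1. References: T. Koma, H. Tasaki, J. Stat. Phys. 76 (1994) 745, §1, §2.4 [KomaTasaki1994];
O. Bratteli, A. Kishimoto, D. W. Robinson, Commun. Math. Phys. 64 (1978) 41, Thm. 2 [BratteliKishimotoRobinson1978];
R. B. Griffiths, Phys. Rev. 152 (1966) 240, §II [Griffiths1966]; D. Ruelle, *Statistical Mechanics* (1969) §3.4
[Ruelle1969]; M. Araújo et al., arXiv:2311.18707, §3.2 Prop. 11 [AraujoEtAl2023].
-/

noncomputable section

namespace Summit.Ventures.CertifiedManyBodySolver.Observables

open Matrix Complex Finset Literature.MathematicalPhysics.QuantumLattice Literature.Probability.LatticeModels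
open Literature.MathematicalPhysics.QuantumLattice.HubbardWave0 ThermodynamicLimit Filter Topology
open Literature.MathematicalPhysics.QuantumManyBody.StateRelaxation
open Literature.MathematicalPhysics.QuantumLattice.InfVolFermionState (TwistFlipIndex twistedFlipAct
  twistedFlipAct_density)
open scoped ComplexOrder ComplexConjugate BigOperators

section GCCell

variable {ω : InfVolFermionState 2} {t' U : ℝ}

/-! ### §1  The grand-canonical cell reader -/

/-- **OP1-C IN IDENTITY FORM, GRAND-CANONICAL CELL.** As `re_sum_twistedFlipAct_expect_ge_of_chargedCell_certificate`
(part 1: gram + neutral `eom` + charged `eom` slack with auxiliary bounds + flip-twisted defects + anti-Hermitian /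
residual + `kkt` cells with Gram slack, read in every translation-invariant minimiser `ω` of `H^{tt'} − μ_c N`,
`|μ' − μ_c| ≤ Δ`), except that the CAP ROW is on the grand-canonical energy at the grid point,
`κ⁺ (u·1 − Γ E^{src}_{μ',0})`, discharged on `ω` by `κ⁺ e^{src}_{μ',0}(ω) ≤ κ⁺ u` (see `meanEnergy_sourced_grid_le_of_cell`) —
so NO hypothesis on the density of `ω` is needed anywhere. Conclusion:
`c − Σ‖aₖ‖ + (Σ_σ μ_σ)(ρ(ω)/2 − ν) − Δ Σᵢ |ccᵢ qᵢ| Bauxᵢ ≤ (1/32) Σ_g Re (α_g ω)(Xw)`.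
[cite: KomaTasaki1994, §1] [cite: BratteliKishimotoRobinson1978, Thm. 2 (p. 47)] [cite: WangEtAl2024, §III]
[cite: AraujoEtAl2023, §3.2 Prop. 11] -/
theorem re_sum_twistedFlipAct_expect_ge_of_chargedCell_certificate_gc {μc μ' Δ : ℝ}
    (hmin : ω.IsMeanEnergyMinimiser (hubbardTTPrimeSourcedInteraction 1 t' U μc dWaveFormFactor 0) 1)
    (hnear : |μ' - μc| ≤ Δ)
    {Λ Λ' : Finset (Site 2)} (hΛ : Λ ⊆ Λ') (h8 : thicken Λ 1 ⊆ Λ') (h0 : thicken ({0} : Finset (Site 2)) 1 ⊆ Λ')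
    (hz : (0 : Site 2) ∈ Λ')
    (Xw : FermionOp Λ') (κp κm u lo : ℝ) (μf : Fin 2 → ℝ) (ν : ℝ)
    (hcap : κp * ω.meanEnergy (hubbardTTPrimeSourcedInteraction 1 t' U μ' dWaveFormFactor 0) 1 ≤ κp * u)
    (hlo : ∀ σ : InfVolFermionState 2, σ.IsTranslationInvariant → σ.density = ω.density →
      κm * lo ≤ κm * σ.meanEnergy (hubbardTTPrimeFermionInteraction 1 t' U) 1)
    {m : Type*} [Fintype m] [DecidableEq m] {Λm : Matrix m m ℂ} (hΛm : Λm.PosSemidef) (O : m → FermionOp Λ')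
    {κ' : Type*} (s : Finset κ') (B : κ' → FermionOp Λ)
    (hB0 : ∀ k ∈ s, (totalNumber : FermionOp Λ) * B k - B k * totalNumber = 0)
    {κc : Type*} (sc : Finset κc) (cc Baux : κc → ℝ) (lc : κc → List (Orb (PolySite Λ) × Bool))
    (haux : ∀ i ∈ sc, |(∑ g : TwistFlipIndex,
        ((ω.twistedFlipAct g).expect Λ' (fermionEmbed (PolySite.incl hΛ) (ladderWord (lc i)))).re) / 32| ≤ Baux i)
    {ι : Type*} (tt : Finset ι) (γ : ι → DihedralGroup 4) (wv : ι → Site 2) (fl mt : ι → Fin 2)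
    (hsh : ∀ l, d4ShiftSet (γ l) (wv l) Λ ⊆ Λ') (bb : ι → ℂ) (yw : ι → List (Orb (PolySite Λ) × Bool))
    {δ : Type*} (ah : Finset δ) (dc : δ → ℝ) (V : δ → FermionOp Λ')
    {κ'' : Type*} (w : Finset κ'') (a : κ'' → ℂ) (word : κ'' → List (Orb (PolySite Λ') × Bool))
    {ε : Type*} (kk : Finset ε) {β : Type*} [Fintype β] [DecidableEq β]
    (G : ε → Matrix β β ℂ) (hG : ∀ e ∈ kk, (G e).PosSemidef) (Bk : ε → β → FermionOp Λ) (qk sk : ε → ℝ)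
    (hqk : ∀ e ∈ kk, ∀ b, (totalNumber : FermionOp Λ) * Bk e b - Bk e b * totalNumber = ((qk e : ℝ) : ℂ) • Bk e b)
    (hsk : ∀ e ∈ kk, Δ * |qk e| ≤ sk e) {c : ℝ}
    (hcert : Xw - (c : ℂ) • (1 : FermionOp Λ') -
        ∑ σ : Fin 2, ((μf σ : ℝ) : ℂ) • (nAt 0 hz σ - ((ν : ℝ) : ℂ) • (1 : FermionOp Λ')) -
        ((κp : ℝ) : ℂ) • (((u : ℝ) : ℂ) • (1 : FermionOp Λ') -
          fermionEmbed (PolySite.incl h0)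
            ((hubbardTTPrimeSourcedInteraction 1 t' U μ' dWaveFormFactor 0).meanEnergyObs 1)) -
        ((κm : ℝ) : ℂ) • (fermionEmbed (PolySite.incl h0) ((hubbardTTPrimeFermionInteraction 1 t' U).meanEnergyObs 1) -
          ((lo : ℝ) : ℂ) • (1 : FermionOp Λ')) =
      gramForm Λm O +
        (∑ k ∈ s, (pairSourceWindowHamiltonianTT' dWaveFormFactor Λ' t' U μ' 0 * fermionEmbed (PolySite.incl hΛ) (B k) -
            fermionEmbed (PolySite.incl hΛ) (B k) * pairSourceWindowHamiltonianTT' dWaveFormFactor Λ' t' U μ' 0) +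
          ∑ i ∈ sc, ((cc i : ℝ) : ℂ) •
            (pairSourceWindowHamiltonianTT' dWaveFormFactor Λ' t' U μ' 0 *
                fermionEmbed (PolySite.incl hΛ) (ladderWord (lc i)) -
              fermionEmbed (PolySite.incl hΛ) (ladderWord (lc i)) *
                pairSourceWindowHamiltonianTT' dWaveFormFactor Λ' t' U μ' 0) +
          ∑ l ∈ tt, bb l • (gaugePhase (twistFlipExp (γ l) (fl l) (mt l)) (yw l) •
              fermionEmbed (PolySite.incl (hsh l))
                (fermionEmbed (PolySite.d4Emb (γ l) (wv l) Λ) (spinSwapIter (fl l).val (ladderWord (yw l)))) -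
            fermionEmbed (PolySite.incl hΛ) (ladderWord (yw l)))) +
        (∑ m' ∈ ah, ((dc m' : ℝ) : ℂ) • ((V m')ᴴ - V m') + ∑ k ∈ w, a k • ladderWord (word k)) +
        ∑ e ∈ kk, (kktForm (pairSourceWindowHamiltonianTT' dWaveFormFactor Λ' t' U μ' 0) (G e)
            (fun b => fermionEmbed (PolySite.incl hΛ) (Bk e b)) +
          ((sk e : ℝ) : ℂ) • gramForm (G e) (fun b => fermionEmbed (PolySite.incl hΛ) (Bk e b)))) :
    c - ∑ k ∈ w, ‖a k‖ + (∑ σ : Fin 2, μf σ) * (ω.density / 2 - ν) -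
        Δ * ∑ i ∈ sc, |cc i * (ladderCharge (lc i) : ℝ)| * Baux i ≤
      (∑ g : TwistFlipIndex, ((ω.twistedFlipAct g).expect Λ' Xw).re) / 32 := by
  -- names
  set Hp : FermionOp Λ' := pairSourceWindowHamiltonianTT' dWaveFormFactor Λ' t' U μ' 0 with hHp
  set Hc : FermionOp Λ' := pairSourceWindowHamiltonianTT' dWaveFormFactor Λ' t' U μc 0 with hHc
  have hshift : Hp = Hc - (((μ' - μc : ℝ)) : ℂ) • (totalNumber : FermionOp Λ') :=
    pairSourceWindowHamiltonianTT'_cell_shift Λ' t' U μc μ'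
  have hshift' : Hp - (((μc - μ' : ℝ)) : ℂ) • (totalNumber : FermionOp Λ') = Hc := by
    rw [hshift, Complex.ofReal_sub, Complex.ofReal_sub, sub_smul, sub_smul]
    abel
  set E : FermionOp Λ' := ∑ k ∈ s, (Hp * fermionEmbed (PolySite.incl hΛ) (B k) -
    fermionEmbed (PolySite.incl hΛ) (B k) * Hp) with hE
  set C : FermionOp Λ' := ∑ i ∈ sc, ((cc i : ℝ) : ℂ) • (Hp * fermionEmbed (PolySite.incl hΛ) (ladderWord (lc i)) -
    fermionEmbed (PolySite.incl hΛ) (ladderWord (lc i)) * Hp) with hC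
  set Df : FermionOp Λ' := ∑ l ∈ tt, bb l • (gaugePhase (twistFlipExp (γ l) (fl l) (mt l)) (yw l) •
      fermionEmbed (PolySite.incl (hsh l))
        (fermionEmbed (PolySite.d4Emb (γ l) (wv l) Λ) (spinSwapIter (fl l).val (ladderWord (yw l)))) -
    fermionEmbed (PolySite.incl hΛ) (ladderWord (yw l))) with hDf
  set K : FermionOp Λ' := ∑ e ∈ kk, (kktForm Hp (G e) (fun b => fermionEmbed (PolySite.incl hΛ) (Bk e b)) +
    ((sk e : ℝ) : ℂ) • gramForm (G e) (fun b => fermionEmbed (PolySite.incl hΛ) (Bk e b))) with hK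
  set D : FermionOp Λ' := (E + C + Df) + K with hD
  -- the identity with the ground-state blocks and defects in `D`
  have hcert' : Xw - (c : ℂ) • (1 : FermionOp Λ') -
        ∑ σ : Fin 2, ((μf σ : ℝ) : ℂ) • (nAt 0 hz σ - ((ν : ℝ) : ℂ) • (1 : FermionOp Λ')) -
        ((κp : ℝ) : ℂ) • (((u : ℝ) : ℂ) • (1 : FermionOp Λ') -
          fermionEmbed (PolySite.incl h0)
            ((hubbardTTPrimeSourcedInteraction 1 t' U μ' dWaveFormFactor 0).meanEnergyObs 1)) -
        ((κm : ℝ) : ℂ) • (fermionEmbed (PolySite.incl h0) ((hubbardTTPrimeFermionInteraction 1 t' U).meanEnergyObs 1) -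
          ((lo : ℝ) : ℂ) • (1 : FermionOp Λ')) =
      gramForm Λm O + D + (∑ m' ∈ ah, ((dc m' : ℝ) : ℂ) • ((V m')ᴴ - V m') + ∑ k ∈ w, a k • ladderWord (word k)) := by
    rw [hcert, hD]
    abel
  -- each transform is again a minimiser; the one-state inequality there
  have hg : ∀ g : TwistFlipIndex,
      c - ∑ k ∈ w, ‖a k‖ + ∑ σ : Fin 2, μf σ * (((ω.twistedFlipAct g).expect Λ' (nAt 0 hz σ)).re - ν) +
          κp * (u - (ω.twistedFlipAct g).meanEnergy (hubbardTTPrimeSourcedInteraction 1 t' U μ' dWaveFormFactor 0) 1) +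
          κm * ((ω.twistedFlipAct g).meanEnergy (hubbardTTPrimeFermionInteraction 1 t' U) 1 - lo) +
          ((ω.twistedFlipAct g).expect Λ' D).re ≤
        ((ω.twistedFlipAct g).expect Λ' Xw).re := fun g =>
    (ω.twistedFlipAct g).re_expect_ge_of_sourced_certificate_TI_rows t' U μ' 0 h0 hz Xw D κp κm u lo μf ν hΛm O ah
      dc V w a word hcert'
  -- (E) the neutral `eom` block vanishes in each transform
  have hEg : ∀ g : TwistFlipIndex, (ω.twistedFlipAct g).expect Λ' E = 0 := by
    intro g
    have hming := hmin.twistedFlipAct g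
    rw [hE, map_sum]
    refine Finset.sum_eq_zero fun k hk => ?_
    have hNB : (totalNumber : FermionOp Λ') * fermionEmbed (PolySite.incl hΛ) (B k) -
        fermionEmbed (PolySite.incl hΛ) (B k) * totalNumber = (0 : ℂ) • fermionEmbed (PolySite.incl hΛ) (B k) :=
      totalNumber_commutator_fermionEmbed_incl_of_commutator hΛ (by rw [hB0 k hk, zero_smul])
    have hcomm : Hp * fermionEmbed (PolySite.incl hΛ) (B k) - fermionEmbed (PolySite.incl hΛ) (B k) * Hp =
        Hc * fermionEmbed (PolySite.incl hΛ) (B k) - fermionEmbed (PolySite.incl hΛ) (B k) * Hc := by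
      rw [hshift, sub_smul_mul_sub_mul_sub_smul_of_commutator Hc totalNumber _ _ hNB, mul_zero, zero_smul, sub_zero]
    rw [hcomm, hHc]
    exact hming.expect_commutator_pairSourceWindowHamiltonianTT'_eq_zero hΛ h8 (B k)
  -- (C) the charged `eom` block: `Re ω_g(C) = −(μ' − μc) Σ_i cc_i q_i Re ω_g(Γ W_i)`
  have hCg : ∀ g : TwistFlipIndex, ((ω.twistedFlipAct g).expect Λ' C).re =
      -(μ' - μc) * ∑ i ∈ sc, cc i * (ladderCharge (lc i) : ℝ) *
        ((ω.twistedFlipAct g).expect Λ' (fermionEmbed (PolySite.incl hΛ) (ladderWord (lc i)))).re := by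
    intro g
    have hming := hmin.twistedFlipAct g
    rw [hC, map_sum, Complex.re_sum, Finset.mul_sum]
    refine Finset.sum_congr rfl fun i _ => ?_
    have hNW := totalNumber_commutator_fermionEmbed_ladderWord hΛ (lc i)
    have hcomm : Hp * fermionEmbed (PolySite.incl hΛ) (ladderWord (lc i)) -
        fermionEmbed (PolySite.incl hΛ) (ladderWord (lc i)) * Hp =
        (Hc * fermionEmbed (PolySite.incl hΛ) (ladderWord (lc i)) -
          fermionEmbed (PolySite.incl hΛ) (ladderWord (lc i)) * Hc) -
          ((((μ' - μc : ℝ)) : ℂ) * ((ladderCharge (lc i) : ℤ) : ℂ)) •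
            fermionEmbed (PolySite.incl hΛ) (ladderWord (lc i)) := by
      rw [hshift]
      exact sub_smul_mul_sub_mul_sub_smul_of_commutator Hc totalNumber _ _ hNW
    have h0c : (ω.twistedFlipAct g).expect Λ' (Hc * fermionEmbed (PolySite.incl hΛ) (ladderWord (lc i)) -
        fermionEmbed (PolySite.incl hΛ) (ladderWord (lc i)) * Hc) = 0 := by
      rw [hHc]
      exact hming.expect_commutator_pairSourceWindowHamiltonianTT'_eq_zero hΛ h8 (ladderWord (lc i))
    rw [map_smul, hcomm, map_sub, h0c, zero_sub, map_smul, smul_eq_mul, smul_eq_mul, Complex.re_ofReal_mul]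
    have e1 : ((((μ' - μc : ℝ)) : ℂ) * ((ladderCharge (lc i) : ℤ) : ℂ)) =
        (((μ' - μc) * (ladderCharge (lc i) : ℝ) : ℝ) : ℂ) := by push_cast; ring
    rw [e1, Complex.neg_re, Complex.re_ofReal_mul]
    ring
  -- (Df) the defects cancel in the orbit sum
  have hDfsum : ∑ g : TwistFlipIndex, ((ω.twistedFlipAct g).expect Λ' Df).re = 0 := by
    have h1 : ∑ g : TwistFlipIndex, (ω.twistedFlipAct g).expect Λ' Df = 0 := by
      simp only [hDf, map_sum, map_smul, smul_eq_mul]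
      rw [Finset.sum_comm]
      refine Finset.sum_eq_zero fun l _ => ?_
      rw [← Finset.mul_sum, hmin.1.sum_twistedFlipAct_expect_twistedFlipDefect_eq_zero hΛ (γ l) (wv l) (hsh l) (fl l)
        (mt l) (yw l), mul_zero]
    rw [← Complex.re_sum, h1, Complex.zero_re]
  -- (K) the `kkt` cells are nonnegative in each transform
  have hKg : ∀ g : TwistFlipIndex, 0 ≤ ((ω.twistedFlipAct g).expect Λ' K).re := by
    intro g
    have hming := hmin.twistedFlipAct g
    have hpos : ∀ A : FermionOp Λ', 0 ≤ (ω.twistedFlipAct g).expect Λ' (star A * A) := fun A => by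
      rw [Matrix.star_eq_conjTranspose]; exact (ω.twistedFlipAct g).expect_nonneg Λ' A
    rw [hK, map_sum, Complex.re_sum]
    refine Finset.sum_nonneg fun e he => ?_
    rw [map_add, Complex.add_re, map_smul, smul_eq_mul, Complex.re_ofReal_mul]
    -- the graded KKT inequality at the exact chemical potential `μc`: `(μ'−μc) q Re(gram) ≤ Re(kkt H')`
    have hgr := mul_re_map_gramForm_le_re_map_kktForm ((ω.twistedFlipAct g).expect Λ') Hp
      (totalNumber : FermionOp Λ') (μc - μ') (qk e) (hG e he) (fun b => fermionEmbed (PolySite.incl hΛ) (Bk e b))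
      (fun b => totalNumber_commutator_fermionEmbed_incl_of_commutator hΛ (hqk e he b)) (fun wt => by
        have hsum : ∑ j, wt j • fermionEmbed (PolySite.incl hΛ) (Bk e j) =
            fermionEmbed (PolySite.incl hΛ) (∑ j, wt j • Bk e j) := by
          rw [map_sum]
          exact Finset.sum_congr rfl fun j _ => (fermionEmbed_smul _ _ _).symm
        rw [hsum, Matrix.star_eq_conjTranspose, hshift', hHc]
        exact hming.re_expect_conj_commutator_pairSourceWindowHamiltonianTT'_nonneg hΛ h8 _)
    have hgram : 0 ≤ ((ω.twistedFlipAct g).expect Λ'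
        (gramForm (G e) (fun b => fermionEmbed (PolySite.incl hΛ) (Bk e b)))).re :=
      (Complex.nonneg_iff.1 (map_gramForm_nonneg ((ω.twistedFlipAct g).expect Λ') hpos (hG e he) _)).1
    have hbd : |(μc - μ') * qk e| ≤ sk e := by
      rw [abs_mul, abs_sub_comm]
      exact (mul_le_mul_of_nonneg_right hnear (abs_nonneg _)).trans (hsk e he)
    have hlow : -(sk e) ≤ (μc - μ') * qk e := (abs_le.1 hbd).1
    nlinarith [hgram, hgr, hlow]
  -- (N) the spin densities balance
  have hNsum : ∑ g : TwistFlipIndex, ∑ σ : Fin 2, μf σ * (((ω.twistedFlipAct g).expect Λ' (nAt 0 hz σ)).re - ν) =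
      32 * ((∑ σ : Fin 2, μf σ) * (ω.density / 2 - ν)) := by
    rw [Finset.sum_comm]
    have hσ : ∀ σ : Fin 2, ∑ g : TwistFlipIndex, μf σ * (((ω.twistedFlipAct g).expect Λ' (nAt 0 hz σ)).re - ν) =
        μf σ * (16 * ω.density - 32 * ν) := by
      intro σ
      rw [← Finset.mul_sum, Finset.sum_sub_distrib, ω.sum_twistedFlipAct_re_expect_nAt_zero hz σ, Finset.sum_const,
        Finset.card_univ, card_twistFlipIndex, nsmul_eq_mul, Nat.cast_ofNat]
    rw [Finset.sum_congr rfl fun σ _ => hσ σ, ← Finset.sum_mul]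
    ring
  -- the energy rows hold in every transform
  have hcapg : ∀ g : TwistFlipIndex,
      0 ≤ κp * (u - (ω.twistedFlipAct g).meanEnergy (hubbardTTPrimeSourcedInteraction 1 t' U μ' dWaveFormFactor 0) 1) := by
    intro g
    rw [hmin.1.meanEnergy_hubbardTTPrimeSourced_twistedFlipAct, mul_sub]
    linarith
  have hlog : ∀ g : TwistFlipIndex,
      0 ≤ κm * ((ω.twistedFlipAct g).meanEnergy (hubbardTTPrimeFermionInteraction 1 t' U) 1 - lo) := by
    intro g
    have hl := hlo (ω.twistedFlipAct g) (hmin.1.twistedFlipAct g) (twistedFlipAct_density g ω)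
    rw [mul_sub]
    linarith
  -- the charged block in the orbit sum is bounded by the auxiliary nodes
  have hCsum : -(32 * (Δ * ∑ i ∈ sc, |cc i * (ladderCharge (lc i) : ℝ)| * Baux i)) ≤
      ∑ g : TwistFlipIndex, ((ω.twistedFlipAct g).expect Λ' C).re := by
    set S : κc → ℝ := fun i => ∑ g : TwistFlipIndex,
      ((ω.twistedFlipAct g).expect Λ' (fermionEmbed (PolySite.incl hΛ) (ladderWord (lc i)))).re with hS
    set X : ℝ := ∑ i ∈ sc, cc i * (ladderCharge (lc i) : ℝ) * S i with hX
    have step1 : ∑ g : TwistFlipIndex, ((ω.twistedFlipAct g).expect Λ' C).re = -(μ' - μc) * X := by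
      simp_rw [hCg]
      rw [← Finset.mul_sum, Finset.sum_comm]
      congr 1
      refine Finset.sum_congr rfl fun i _ => ?_
      rw [hS, Finset.mul_sum]
    have hSi : ∀ i ∈ sc, |S i| ≤ 32 * Baux i := by
      intro i hi
      have h := haux i hi
      rw [abs_div, abs_of_pos (by norm_num : (0 : ℝ) < 32), div_le_iff₀ (by norm_num : (0 : ℝ) < 32)] at h
      simpa only [hS, mul_comm] using h
    have step3 : |X| ≤ 32 * ∑ i ∈ sc, |cc i * (ladderCharge (lc i) : ℝ)| * Baux i := by
      rw [hX, Finset.mul_sum]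
      refine (Finset.abs_sum_le_sum_abs _ _).trans (Finset.sum_le_sum fun i hi => ?_)
      rw [abs_mul]
      have := mul_le_mul_of_nonneg_left (hSi i hi) (abs_nonneg (cc i * (ladderCharge (lc i) : ℝ)))
      linarith
    have hB : |(μ' - μc) * X| ≤ Δ * (32 * ∑ i ∈ sc, |cc i * (ladderCharge (lc i) : ℝ)| * Baux i) := by
      rw [abs_mul]
      exact mul_le_mul hnear step3 (abs_nonneg _) ((abs_nonneg _).trans hnear)
    have hle := le_abs_self ((μ' - μc) * X)
    rw [step1]
    linarith
  -- sum the one-state inequalities over the orbit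
  have hsum := Finset.sum_le_sum fun g (_ : g ∈ (Finset.univ : Finset TwistFlipIndex)) => hg g
  have hDg : ∀ g : TwistFlipIndex, ((ω.twistedFlipAct g).expect Λ' D).re =
      ((ω.twistedFlipAct g).expect Λ' C).re + ((ω.twistedFlipAct g).expect Λ' Df).re +
        ((ω.twistedFlipAct g).expect Λ' K).re := by
    intro g
    rw [hD, map_add, map_add, map_add, hEg g, zero_add, Complex.add_re, Complex.add_re]
  have hDsum : ∑ g : TwistFlipIndex, ((ω.twistedFlipAct g).expect Λ' D).re =
      ∑ g : TwistFlipIndex, ((ω.twistedFlipAct g).expect Λ' C).re +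
        ∑ g : TwistFlipIndex, ((ω.twistedFlipAct g).expect Λ' K).re := by
    rw [Finset.sum_congr rfl fun g (_ : g ∈ (Finset.univ : Finset TwistFlipIndex)) => hDg g,
      Finset.sum_add_distrib, Finset.sum_add_distrib, hDfsum, add_zero]
  have hKsum : 0 ≤ ∑ g : TwistFlipIndex, ((ω.twistedFlipAct g).expect Λ' K).re :=
    Finset.sum_nonneg fun g _ => hKg g
  rw [Finset.sum_add_distrib, Finset.sum_add_distrib, Finset.sum_add_distrib, Finset.sum_add_distrib, hDsum, hNsum,
    Finset.sum_const, Finset.card_univ, card_twistFlipIndex, nsmul_eq_mul, Nat.cast_ofNat] at hsum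
  have hp := Finset.sum_nonneg fun g (_ : g ∈ (Finset.univ : Finset TwistFlipIndex)) => hcapg g
  have hm := Finset.sum_nonneg fun g (_ : g ∈ (Finset.univ : Finset TwistFlipIndex)) => hlog g
  rw [le_div_iff₀ (by norm_num : (0 : ℝ) < 32)]
  linarith


end GCCell

end Summit.Ventures.CertifiedManyBodySolver.Observables

end
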